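import Summits.BirchSwinnertonDyer.Rank1Residual.Additive.X4ThreeKuriharaCertKernelIntegral
import Summits.BirchSwinnertonDyer.Rank1Residual.Additive.X4SharpThreeKimConjectureEndState
import Summits.BirchSwinnertonDyer.Rank1Residual.X4.KimDefectLevelLowering
import Literature.NumberTheory.EllipticCurves.CuspFormLFunctionLevelConductorProofs
import HarnessLib

/-!
# N11 LOWER@3 Kurihara-certificate records: the Tamagawa-DEFECT rows close to `BSD(E,3)` WITHOUT the
# covered-locus reading `hcov` when the Tamagawa `3` sits at a split multiplicative prime — LOWER from
# the level-`2` Kurihara certificate, UPPER from additive-p4's LEVEL-LOWERING certificate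
# (cell `b2b-bsdres`, team n1011, seat p03, OWNERS row T-a2-REC; kernel tool, sequel of
# `X4ThreeKuriharaCertKernel{,Integral}` p253917 / p255408 over additive-p4's `X4/KuriharaLevelLowering`,
# `X4/KimDefectLevelLowering` p260566–p261202 and `X4SharpThreeKimConjectureEndState`)

HONEST FRAMING (cell `b2b-bsdres`, run/shared/lean/b2b/bsd-rank1-residual/, verbatim in every
file): the goal of the cell is to DELETE the COMBINATION-SHAPED residual classes of the
Birch–Swinnerton-Dyer formula for ALL analytic-rank `≤ 1` elliptic curves over `ℚ` — "full BSD
formula for every rank `≤ 1` curve in class `C`" assembled STRICTLY from published theorems — so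
that the rank-`≤ 1` remainder becomes exactly the CONSTRUCTION-SHAPED classes, which are TYPED
(missing-input `Prop`s), NOT attempted. This is not "finishing BSD". Team n1011 is a RESEARCH ROUTE;
no claim beyond the stated classes; the label X4 and the mark of RESIDUAL-MAP §I N11 (LOWER@3) are
UNCHANGED; PER-PAIR record SHAPES, not a class theorem; nothing is booked by this file. Every shape is
CONDITIONAL on the ANNOUNCED C.-H. Kim (app. R. Pollack), arXiv:2505.09121v1 (2025, PREPRINT)
Thm. 1.1 — binder `hK25s`, FLAG `Kim2025-preprint`. Theorems only (no definition, no named fact).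

## What this file does

The kernel tool's Tamagawa-DEFECT shape `X4RankZero.bsdp_three_of_optimal_of_towerSurj_of_kuriharaIndexLeAt_of_cov`
(`X4ThreeKuriharaCertKernelIntegral`) closes `BSD(E,3)` on a defect row (`3 ∣ ∏ c_ℓ`) only on the
COVERED LOCUS `hcov` (`ord₃ j < 0`, or `ord₃ ∏ c_ℓ = ord₃ c₃` with the sharp Kato reading): a row whose
Tamagawa `3` sits at a prime `ℓ ≠ 3` (E2-AT3 STAGE-2 row `17127b1`: `c₃ = 2`, `c₁₇₃ = 3` at a split `I₃`)
got the LOWER half only. additive-p4's line V39 supplies the missing UPPER input on exactly those rows: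
a LEVEL-LOWERING CERTIFICATE `LevelLowering.PlusSymbolLevelLowersAt W p D.f ℓ` (FINITE: a periodic
`μ : ℚ → ℤ/p`, `T_q`-eigen at the Kolyvagin primes, with `[r]⁺_f ≡ μ(r) − μ(ℓr)`; it exists when
`p ∣ c_ℓ` at a split multiplicative `ℓ ∥ N` by Ribet's level lowering + mod-`p` multiplicity one, and is
decided per pair by additive-p4's instrument `llcert.gp` — EVIDENCE, kit jobs, never a fact) forces EVERY
mod-`p` Kurihara number to vanish, hence `1 ≤ ∂^{(∞)}` (`one_le_kuriharaPartialInfty_of_plusSymbolLevelLowersAt`)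
and the `≥` half of Kim's Conjecture 1.10 on a row with `ord_p ∏ c_ℓ ≤ 1`
(`X4.kimTamagawaDefectGeAt_of_plusSymbolLevelLowersAt_of_tamagawa_le_one`, class-free, `p` odd). At
`p = 3` on a tower row the `≥` half IS the UPPER half of `BSD₃`, CONDITIONAL on [K25]
(additive-p4's `missingUpperBoundAt_iff_kimTamagawaDefectGeAt_of_kim2025_OPEN`). Composing:
* `X4RankZero.missingUpperBoundAt_three_of_optimal_of_towerSurj_of_plusSymbolLevelLowersAt` — UPPER@3
  on a tower row with `r_an = 0`, an optimal datum at level `N ≤ 130000`, `N = N_E`, a level-lowering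
  certificate at some `ℓ ∣ N_E`, and `ord₃ ∏ c_ℓ ≤ 1`; NO `hcov`, NO Cassels–Tate, NO `#Ш_an`;
* `X4RankZero.bsdp_three_of_optimal_of_towerSurj_of_kuriharaIndexLeAt_of_plusSymbolLevelLowersAt` —
  `BSD(E,3) ∧ MissingPPartAt W 3` from the level-`k` Kurihara certificate (`KuriharaIndexLeAt`, LOWER:
  `∂^{(∞)} ≤ ord₃ ∏ c_ℓ`) AND the level-lowering certificate (UPPER: `∂^{(∞)} ≥ 1 = ord₃ ∏ c_ℓ`) — i.e.
  `∂^{(∞)} = ord₃ ∏ c_ℓ = 1` EXACTLY, Kim's Conjecture 1.10 verified on the row by two certificates;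
* `…_of_level_…` — the same with the LEVEL SLOT (`k`, `n ∈ 𝒩_k` cyclic, `δ̃_n^{(k)} ≢ 0 (mod 3^k)`) open,
  the interface of the records generator;
* `…_of_exists_isNewformOf` — the conductor identity `N_E = N` of the datum DISCHARGED by modularity in
  the tree's form `exists_isNewformOf` (Carayol's level theorem via strong multiplicity one,
  `IsNewformOf.level_eq_conductorNorm_of_exists_isNewformOf`), for records that prefer a named fact to a
  kernel conductor certificate.
Remaining inputs per pair: `r_an = 0`, the optimal datum, the two CERTIFICATES (Kurihara VALUE at a named
cyclic level — two engines; level-lowering `μ` — additive-p4's instrument), `ord₃ ∏ c_ℓ ≤ 1` (a kernel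
numeral per row via `IntModelTamagawaCertificate`). Rows in view (E2-AT3 STAGE 2, `HOME/…/V39-LEVEL-LOWERING.md`):
`17127b1` (`ℓ = 173`, certificate HOLDS per additive-p4 kit j128710-series) — previously LOWER-only — and
`13221g1` (`ℓ = 113`; also covered by `hcov`, `ord₃ j < 0`). Nothing is booked; class X4 stays
CONSTRUCTION-SHAPED.

References: [Kim2025RefinedTNC] Thm. 1.1, Cor. 1.7, App. §8.1.2 (PREPRINT); [Kim2022StructureSelmer]
§1.2.2, §1.4.3, §1.5.1, Thm. 1.9 (6), Conj. 1.10; [AgasheRibetStein2006] Thm. 2.6; [AtkinLehner1970]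
Thm. 4; [DiamondShurman2005] Thm. 8.8.1; [MazurTateTeitelbaum1986Invent] §I.4; [Miller2011LMS] Def. 1.1;
cell files cells/n1011/skel/T-a2-REC.md §5 (DEF rows), HOME/b2b-bsdres-additive-p4/V39-LEVEL-LOWERING.md.
-/

noncomputable section

open scoped Classical MatrixGroups ModularForm

open CongruenceSubgroup WeierstrassCurve Literature.NumberTheory.EllipticCurves
  Literature.NumberTheory.EllipticCurves.ModularForms
  Literature.NumberTheory.EllipticCurves.Rank1Residual
  Literature.NumberTheory.EllipticCurves.Rank1Residual.Typed
  Literature.NumberTheory.EllipticCurves.AgasheRibetStein2006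
  Summit.BirchSwinnertonDyer.BirchSwinnertonDyer.Rank1Residual.IntModel
  Summit.BirchSwinnertonDyer.Rank1Residual.LevelLowering

namespace Summit.BirchSwinnertonDyer.Rank1Residual.Additive

open Summit.BirchSwinnertonDyer.Rank1Residual.X4

variable (W : WeierstrassCurve ℚ) [W.IsElliptic] [W.IsGloballyMinimal]

/-! ### §1 UPPER@3 from the level-lowering certificate on a Tamagawa-defect-ONE row -/

/-- **UPPER@3 WITHOUT `hcov`**: globally minimal elliptic `W/ℚ`, the `3`-adic tower onto, `r_an = 0`,
an OPTIMAL datum `D` at level `N ≤ 130000` (so `3 ∤ c_D` by ARS Thm. 2.6 `h26` and the period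
transfer holds) with `N = N_E`, a LEVEL-LOWERING CERTIFICATE `PlusSymbolLevelLowersAt W 3 D.f ℓ` at
some `ℓ ∣ N_E`, and `ord₃ ∏ c_ℓ ≤ 1` ⟹ `MissingUpperBoundAt W 3`, CONDITIONAL on [K25] (`hK25s`),
GZK, modularity. Chain: certificate ⟹ `1 ≤ ∂^{(∞)}` ⟹ `KimTamagawaDefectGeAt` (additive-p4, class-free)
⟹ UPPER (additive-p4's `missingUpperBoundAt_iff_kimTamagawaDefectGeAt_of_kim2025_OPEN`, the
`Ω⁺_f`-integrality being p09's theorem on tower rows). Per pair; nothing booked.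
[claim: Kim2025RefinedTNC, status: under-review]
[cite: Kim2025RefinedTNC, Thm. 1.1 ("BSD") (ANNOUNCED preprint — the reason, not a source of truth)]
[cite: Kim2022StructureSelmer, §1.4.3, §1.5.1 and Conj. 1.10 (PDF pp. 7–8)]
[cite: AgasheRibetStein2006, Thm. 2.6 (p. 619)] [cite: Miller2011LMS, §1 and Def. 1.1] -/
theorem X4RankZero.missingUpperBoundAt_three_of_optimal_of_towerSurj_of_plusSymbolLevelLowersAt
    (hK25s : Kim2025.thm11_kimShaLength_of_integralPeriod_OPEN)
    (hGZK : rank_eq_analyticRank_of_analyticRank_le_one) (hmod : hasEntireLFunction_rat)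
    (h26 : cremona_abs_maninConstant_eq_one_of_level_le)
    (htower : ∀ n : ℕ, W.HasSurjectiveModNGaloisRep (3 ^ n : ℕ)) (hr : W.analyticRank = 0)
    {N : ℕ} [NeZero N] (hN : N ≤ 130000) (D : ModularParametrizationData W N)
    (hopt : ∀ z ∈ D.L.lattice, ∃ w ∈ periodLattice D.f, z = D.c * w)
    (hcond : W.conductorNorm ℤ = N)
    {ℓ : ℕ} (hcert : haveI : Fact (Nat.Prime 3) := ⟨Nat.prime_three⟩; PlusSymbolLevelLowersAt W 3 D.f ℓ)
    (hℓ : ℓ ∣ W.conductorNorm ℤ) (hc1 : padicValNat 3 W.tamagawaProduct ≤ 1) :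
    haveI : Fact (Nat.Prime 3) := ⟨Nat.prime_three⟩
    MissingUpperBoundAt W 3 := by
  haveI : Fact (Nat.Prime 3) := ⟨Nat.prime_three⟩
  have hc : ¬ (3 : ℤ) ∣ D.maninConstant := not_dvd_maninConstant_of_level_le h26 W D hopt hN Nat.prime_three
  have hper : ∃ u : ℚ, ‖(u : ℚ_[3])‖ = 1 ∧ W.realPeriodRat = u * plusPeriod D.f :=
    periodTransfer_of_optimal 3 D hopt hc
  have hint : ∀ r : ℚ, ratPlusSymbol D.f r ≠ 0 → 0 ≤ padicValRat 3 (ratPlusSymbol D.f r) :=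
    forall_padicValRat_ratPlusSymbol_nonneg_of_towerSurj (by norm_num) D.isNewformOf htower
  have hsurj : W.HasSurjectiveModNGaloisRep 3 := by simpa using htower 1
  have hirr := hasIrreducibleModPGaloisRep_of_hasSurjectiveModNGaloisRep W 3 hsurj
  exact (missingUpperBoundAt_iff_kimTamagawaDefectGeAt_of_kim2025_OPEN W 3 hK25s hGZK hmod le_rfl hr
    htower D hper hint).mpr
    (kimTamagawaDefectGeAt_of_plusSymbolLevelLowersAt_of_tamagawa_le_one W 3 (by norm_num) hirr D hcond
      hcert hℓ hc1)

/-! ### §2 `BSD(E,3)` on a Tamagawa-defect-ONE row from the two certificates -/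

/-- **T-a2-REC Tamagawa-defect shape WITHOUT `hcov`: `BSD(E,3) ∧ MissingPPartAt W 3` from the Kurihara
certificate (LOWER) and the level-lowering certificate (UPPER).** Hypotheses: [K25] `hK25s`, GZK,
modularity, ARS Thm. 2.6; the `3`-adic tower; `r_an = 0`; an optimal datum `D` at level `N ≤ 130000` with
`N = N_E`; a Kurihara certificate `KuriharaIndexLeAt W 3 D.f (ord₃ ∏ c_ℓ)` (`∂^{(∞)} ≤ ord₃ ∏ c_ℓ`); a
level-lowering certificate at some `ℓ ∣ N_E` (`∂^{(∞)} ≥ 1`); `ord₃ ∏ c_ℓ ≤ 1`. So `∂^{(∞)} = ord₃ ∏ c_ℓ`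
— Kim's Conjecture 1.10 verified on the row by two finite certificates — and [K25] turns it into
`BSD₃`. Per pair; nothing booked. [claim: Kim2025RefinedTNC, status: under-review]
[cite: Kim2025RefinedTNC, Thm. 1.1 ("BSD"), App. §8.1.2 (ANNOUNCED preprint — the reason, not a source of truth)]
[cite: Kim2022StructureSelmer, §1.2.2, §1.4.3, Conj. 1.10 (PDF pp. 5–8)]
[cite: AgasheRibetStein2006, Thm. 2.6 (p. 619)] [cite: Miller2011LMS, §1 and Def. 1.1] -/
theorem X4RankZero.bsdp_three_of_optimal_of_towerSurj_of_kuriharaIndexLeAt_of_plusSymbolLevelLowersAt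
    (hK25s : Kim2025.thm11_kimShaLength_of_integralPeriod_OPEN)
    (hGZK : rank_eq_analyticRank_of_analyticRank_le_one) (hmod : hasEntireLFunction_rat)
    (h26 : cremona_abs_maninConstant_eq_one_of_level_le)
    (htower : ∀ n : ℕ, W.HasSurjectiveModNGaloisRep (3 ^ n : ℕ)) (hr : W.analyticRank = 0)
    {N : ℕ} [NeZero N] (hN : N ≤ 130000) (D : ModularParametrizationData W N)
    (hopt : ∀ z ∈ D.L.lattice, ∃ w ∈ periodLattice D.f, z = D.c * w)
    (hcond : W.conductorNorm ℤ = N)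
    (hK : haveI : Fact (Nat.Prime 3) := ⟨Nat.prime_three⟩;
      KuriharaIndexLeAt W 3 D.f (padicValNat 3 W.tamagawaProduct))
    {ℓ : ℕ} (hcert : haveI : Fact (Nat.Prime 3) := ⟨Nat.prime_three⟩; PlusSymbolLevelLowersAt W 3 D.f ℓ)
    (hℓ : ℓ ∣ W.conductorNorm ℤ) (hc1 : padicValNat 3 W.tamagawaProduct ≤ 1) :
    haveI : Fact (Nat.Prime 3) := ⟨Nat.prime_three⟩
    BSDp W 3 ∧ MissingPPartAt W 3 := by
  haveI : Fact (Nat.Prime 3) := ⟨Nat.prime_three⟩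
  have hpp : MissingPPartAt W 3 :=
    missingPPartAt_of_lower_of_upper W 3
      (X4RankZero.missingLowerBoundAt_three_of_optimal_of_towerSurj_of_kuriharaIndexLeAt W hK25s hGZK
        hmod h26 htower hr hN D hopt hK)
      (X4RankZero.missingUpperBoundAt_three_of_optimal_of_towerSurj_of_plusSymbolLevelLowersAt W hK25s
        hGZK hmod h26 htower hr hN D hopt hcond hcert hℓ hc1)
  exact ⟨bsdp_of_missingPPartAt W 3 hGZK (by rw [hr]; exact zero_le_one) hpp, hpp⟩

/-- **The same with the LEVEL SLOT open** (records interface): a level `k` with `1 ≤ k ≤ ord₃ ∏ c_ℓ + 1`,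
a cyclic `n ∈ 𝒩_k(E,3)` (`#Ẽ(𝔽_q)[3] ≤ 3` for `q ∣ n`, kernel point counts / one `Ψ₃` root) and
`δ̃_n^{(k)} ≢ 0 (mod 3^k)` for some surjective `ψ` (the two-engine VALUE) in place of `KuriharaIndexLeAt`.
Per pair; nothing booked. [claim: Kim2025RefinedTNC, status: under-review]
[cite: Kim2025RefinedTNC, Thm. 1.1 ("BSD"), App. §8.1.2 (ANNOUNCED preprint — the reason, not a source of truth)]
[cite: Kim2022StructureSelmer, §1.2.2 and Thm. 1.10 (1)] [cite: Miller2011LMS, §1 and Def. 1.1] -/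
theorem X4RankZero.bsdp_three_of_optimal_of_towerSurj_of_level_of_plusSymbolLevelLowersAt
    (hK25s : Kim2025.thm11_kimShaLength_of_integralPeriod_OPEN)
    (hGZK : rank_eq_analyticRank_of_analyticRank_le_one) (hmod : hasEntireLFunction_rat)
    (h26 : cremona_abs_maninConstant_eq_one_of_level_le)
    (htower : ∀ n : ℕ, W.HasSurjectiveModNGaloisRep (3 ^ n : ℕ)) (hr : W.analyticRank = 0)
    {N : ℕ} [NeZero N] (hN : N ≤ 130000) (D : ModularParametrizationData W N)
    (hopt : ∀ z ∈ D.L.lattice, ∃ w ∈ periodLattice D.f, z = D.c * w)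
    (hcond : W.conductorNorm ℤ = N)
    (k n : ℕ) [NeZero n] (hk : 1 ≤ k) (hkt : k ≤ padicValNat 3 W.tamagawaProduct + 1)
    (hn : Kato.IsKolyvaginProduct W 3 k n)
    (hcyc : ∀ (q : ℕ) [Fact q.Prime], q ∣ n →
      Nat.card {P : ((WeierstrassCurve.integralModelInt W).map
          (Int.castRingHom (ZMod q))).toAffine.Point // 3 • P = 0} ≤ 3)
    (hδ : ∃ ψ : (q : ℕ) → (ZMod q)ˣ →* Multiplicative (ZMod (3 ^ k)),
      (∀ q ∈ n.primeFactors, Function.Surjective (ψ q)) ∧ kuriharaNumber D.f (3 ^ k) n ψ ≠ 0)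
    {ℓ : ℕ} (hcert : haveI : Fact (Nat.Prime 3) := ⟨Nat.prime_three⟩; PlusSymbolLevelLowersAt W 3 D.f ℓ)
    (hℓ : ℓ ∣ W.conductorNorm ℤ) (hc1 : padicValNat 3 W.tamagawaProduct ≤ 1) :
    haveI : Fact (Nat.Prime 3) := ⟨Nat.prime_three⟩
    BSDp W 3 ∧ MissingPPartAt W 3 :=
  haveI : Fact (Nat.Prime 3) := ⟨Nat.prime_three⟩
  X4RankZero.bsdp_three_of_optimal_of_towerSurj_of_kuriharaIndexLeAt_of_plusSymbolLevelLowersAt W hK25s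
    hGZK hmod h26 htower hr hN D hopt hcond
    (kuriharaIndexLeAt_of_level 3 D.f (padicValNat 3 W.tamagawaProduct) k n hk hkt hn hcyc hδ) hcert hℓ hc1

/-! ### §3 The conductor identity of the datum from modularity -/

omit [W.IsGloballyMinimal] in
/-- **`N_E = N` for a datum at level `N`, from modularity** (`exists_isNewformOf`: every elliptic `W/ℚ`
has a newform at its conductor level; then strong multiplicity one across levels pins the level of
`D.f` — Carayol's theorem in the tree's form `IsNewformOf.level_eq_conductorNorm_of_exists_isNewformOf`).
[cite: AtkinLehner1970, Thm. 4] [cite: DiamondShurman2005, Thm. 8.8.1] -/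
theorem conductorNorm_eq_level_of_exists_isNewformOf (hnf : exists_isNewformOf)
    {N : ℕ} [NeZero N] (D : ModularParametrizationData W N) : W.conductorNorm ℤ = N :=
  (IsNewformOf.level_eq_conductorNorm_of_exists_isNewformOf hnf D.isNewformOf).symm

/-- **§2's level-slot shape with `N_E = N` DISCHARGED by modularity** (`hnf : exists_isNewformOf`, a
PUBLISHED named fact — Breuil–Conrad–Diamond–Taylor) and `ℓ ∣ N` a numeral check. Per pair; nothing
booked. [claim: Kim2025RefinedTNC, status: under-review]
[cite: Kim2025RefinedTNC, Thm. 1.1 ("BSD"), App. §8.1.2 (ANNOUNCED preprint — the reason, not a source of truth)]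
[cite: AtkinLehner1970, Thm. 4] [cite: DiamondShurman2005, Thm. 8.8.1] [cite: Miller2011LMS, §1 and Def. 1.1] -/
theorem X4RankZero.bsdp_three_of_optimal_of_towerSurj_of_level_of_plusSymbolLevelLowersAt_of_exists_isNewformOf
    (hK25s : Kim2025.thm11_kimShaLength_of_integralPeriod_OPEN)
    (hGZK : rank_eq_analyticRank_of_analyticRank_le_one) (hmod : hasEntireLFunction_rat)
    (hnf : exists_isNewformOf) (h26 : cremona_abs_maninConstant_eq_one_of_level_le)
    (htower : ∀ n : ℕ, W.HasSurjectiveModNGaloisRep (3 ^ n : ℕ)) (hr : W.analyticRank = 0)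
    {N : ℕ} [NeZero N] (hN : N ≤ 130000) (D : ModularParametrizationData W N)
    (hopt : ∀ z ∈ D.L.lattice, ∃ w ∈ periodLattice D.f, z = D.c * w)
    (k n : ℕ) [NeZero n] (hk : 1 ≤ k) (hkt : k ≤ padicValNat 3 W.tamagawaProduct + 1)
    (hn : Kato.IsKolyvaginProduct W 3 k n)
    (hcyc : ∀ (q : ℕ) [Fact q.Prime], q ∣ n →
      Nat.card {P : ((WeierstrassCurve.integralModelInt W).map
          (Int.castRingHom (ZMod q))).toAffine.Point // 3 • P = 0} ≤ 3)
    (hδ : ∃ ψ : (q : ℕ) → (ZMod q)ˣ →* Multiplicative (ZMod (3 ^ k)),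
      (∀ q ∈ n.primeFactors, Function.Surjective (ψ q)) ∧ kuriharaNumber D.f (3 ^ k) n ψ ≠ 0)
    {ℓ : ℕ} (hcert : haveI : Fact (Nat.Prime 3) := ⟨Nat.prime_three⟩; PlusSymbolLevelLowersAt W 3 D.f ℓ)
    (hℓN : ℓ ∣ N) (hc1 : padicValNat 3 W.tamagawaProduct ≤ 1) :
    haveI : Fact (Nat.Prime 3) := ⟨Nat.prime_three⟩
    BSDp W 3 ∧ MissingPPartAt W 3 :=
  haveI : Fact (Nat.Prime 3) := ⟨Nat.prime_three⟩
  have hcond : W.conductorNorm ℤ = N := conductorNorm_eq_level_of_exists_isNewformOf W hnf D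
  X4RankZero.bsdp_three_of_optimal_of_towerSurj_of_level_of_plusSymbolLevelLowersAt W hK25s hGZK hmod h26
    htower hr hN D hopt hcond k n hk hkt hn hcyc hδ hcert (by rw [hcond]; exact_mod_cast hℓN) hc1

end Summit.BirchSwinnertonDyer.Rank1Residual.Additive

end
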